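import Literature.Probability.Percolation.FourArmInnerBoundaryCut
import Literature.Probability.Percolation.HexBoundaryGeometry
import HarnessLib

/-!
# Pivotal sites of the four-arm event near the inner boundary: per-site bounds (proofs only)

Topic `Literature/Probability/Percolation`; family `crit-perc`. PROOFS ONLY (no definition, no
named fact). Sequel of `FourArmInnerBoundaryCut.lean`: the per-site estimates for the pivotal
sites `v` of the tree's order-free four-arm event `armEvent ![T,F,T,F] r₀ N` in the INNER boundary
layer `r₀ ≤ |v|_𝕋 < 2r₀` (P. Nolin, *Near-critical percolation in two dimensions*, EJP 13 (2008),
§6.2, proof of Thm. 27, Case 1 "`v` close to `∂S_n`", with §4.6; W. Werner, PCMI 2009, Lecture 6,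
§5), mirror images of the outer-layer bounds of `FourArmPivotalBoundary.lean`
(`measureReal_isPivotal_fourArm_boundary_le`, `…_two_le`), with the OUTER four arms
`armEvent ![T,F,T,F] R₂ N` in place of the inner ones:

* `measureReal_dom_outer_local_eq` — the product formula for an event `C` determined by sites
  `z` with `|z|_𝕋 < R₂`, `|z - v|_𝕋 > R`, the outer four-arm event, and a local event around `v`
  (independence of three disjoint site sets);
* `measureReal_le_of_subset_local_domOut` — union bound over the local shapes of
  `pivotalPlus/Minus_subset_local` (four arms up to the defect, six arms beyond it);
* `measureReal_isPivotal_fourArm_innerBoundary_le` — **three factors**: for `|v|_𝕋 = k = r₀ + d'`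
  (depth `d' ≥ 2^{l+1}`), `P_t(v pivotal) ≤ P_t(B_{T,F}(d₂ + d', D - d')) · π̂_t(R₂, N) · (L_T + L_F)`
  with the local factors `L_c` of `measureReal_isPivotal_fourArm_le` and the mixed half-plane pair
  `B_{T,F}(m, n) = domArmEvent ![T,F] m n upperHalfPlane`, PROVIDED the exterior of `Λ°_{r₀}` seen
  from `v` inside the box `Λ_D(v)` lies in a half-plane at depth `d'` (hypothesis `hdom`; near the
  six corners of `Λ_{r₀}` the exterior is not convex, and `hdom` holds for `D + d'` smaller than
  the distance of `v` to the corners: `exists_rot_halfPlane_superset_inner`);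
* `measureReal_isPivotal_fourArm_innerBoundary_two_le` — **two factors** (local factor dropped,
  any depth `d' ≥ 0`).

## References

* P. Nolin, Near-critical percolation in two dimensions, *Electron. J. Probab.* 13 (2008), §4.6,
  §6.2 (proof of Thm. 27, Cases 1 and 3) [arXiv 0711.4948: Thm. 26] [Nolin2008].
* W. Werner, *Lectures on two-dimensional critical percolation*, IAS/Park City Math. Ser. 16
  (2009), Lecture 6, §5 and proof of Lemma 6.2 (boundary contributions) [WernerPCMI2009].
* H. Kesten, Scaling relations for 2D-percolation, *Comm. Math. Phys.* 109 (1987), Lemma 8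
  [KestenScalingCMP1987].

Tree: `shiftIn_mem_domArmEvent_mixed_of_isPivotal` (`FourArmInnerBoundaryCut.lean`),
`pivotalPlus_subset_local`, `pivotalMinus_subset_local`, `armEvent_altFour_eq`
(`FourArmPivotalBound.lean`), `isPivotal_armEvent_subset_outer` (`ArmEventPivotalAnnuli.lean`),
`exists_rot_halfPlane_superset`, `shift_mem_domArmEvent_recenter`, `real_domArmEvent_rotPow`
(`OneArmBoundaryArms.lean`), `relabel_shift_shift`, `determinedBy_preimage_shift`
(`OneArmPivotalLayer.lean`), `determinedBy_domArmEvent` (`HalfPlaneArmEvents.lean`),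
`determinedBy_armEvent` (`ArmEventsStructure.lean`), `sitePercolation_real_inter_of_disjoint`,
`sitePercolation_real_preimage_relabel` (`SitePercolationMeasure.lean`), `fourArmProbAt`
(`WernerPivotalEstimates.lean`), `triRotIsoPow` API (`ArmSeparationRotate.lean`, `HexBoundaryGeometry.lean`: `triRotIsoPow_apply_add/sub`).
-/

noncomputable section

open MeasureTheory Set

namespace Literature.Probability.Percolation

open LatticeModels

/-! ### Independence with an abstract domain event and the outer four arms -/

section Dom

variable {R₂ N : ℕ} {v : Site 2} {C : Set (SiteConfig (Site 2))} {H : Finset (Site 2)}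

/-- **Product formula**: an event `C` determined by sites `z` with `|z|_𝕋 < R₂` and
`|z - v|_𝕋 > R`, the outer four-arm event `armEvent ![T,F,T,F] R₂ N` (sites of norm `≥ R₂`), and
the translate to `v` of an event `E` determined by sites of norm `≤ R` are independent
(`|v|_𝕋 + R < R₂`). [cite: Nolin2008, §6.2, proof of Thm. 27 ("by independence of the three events")] -/
theorem measureReal_dom_outer_local_eq (t : unitInterval) {R : ℕ} {E : Set (SiteConfig (Site 2))}
    {GE : Finset (Site 2)} (hE : DeterminedBy E ↑GE) (hGE : ∀ u ∈ GE, triNorm u ≤ R)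
    (hR₂N : R₂ ≤ N) (hvR₂ : triNorm v + R < R₂) (hCH : DeterminedBy C ↑H)
    (hHm : ∀ z ∈ H, triNorm z < R₂ ∧ (R : ℤ) < triNorm (z - v)) :
    (triSitePercolation t).real
        (C ∩ armEvent ![true, false, true, false] R₂ N ∩
          SiteConfig.relabel (triShiftIso (-v)).toEquiv ⁻¹' E) =
      (triSitePercolation t).real C * fourArmProbAt t R₂ N * (triSitePercolation t).real E := by
  classical
  set e := (triShiftIso (-v)).toEquiv with he
  set A : Set (SiteConfig (Site 2)) := armEvent ![true, false, true, false] R₂ N with hA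
  set B : Set (SiteConfig (Site 2)) := SiteConfig.relabel e ⁻¹' E with hB
  set F : Finset (Site 2) := triAnnulus R₂ N with hF
  set G : Finset (Site 2) := GE.image fun u => u + v with hG
  have hAF : DeterminedBy A ↑F := determinedBy_armEvent _ hR₂N
  have hBG : DeterminedBy B ↑G := determinedBy_preimage_shift hE v
  have hGmem : ∀ z ∈ G, triNorm z ≤ triNorm v + R ∧ triNorm (z - v) ≤ R := by
    intro z hz
    rw [hG, Finset.mem_image] at hz
    obtain ⟨u, hu, rfl⟩ := hz
    have h0 := hGE u hu
    have h1 := triNorm_add_le u v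
    rw [add_sub_cancel_right]
    constructor <;> omega
  have hFG : Disjoint F G := Finset.disjoint_left.2 fun z hzF hzG => by
    rw [hF, mem_triAnnulus] at hzF; have := (hGmem z hzG).1; omega
  have hFH : Disjoint F H := Finset.disjoint_left.2 fun z hzF hzH => by
    rw [hF, mem_triAnnulus] at hzF; have := (hHm z hzH).1; omega
  have hGH : Disjoint G H := Finset.disjoint_left.2 fun z hzG hzH => by
    have := (hHm z hzH).2; have := (hGmem z hzG).2; omega
  have hCA : DeterminedBy (C ∩ A) ↑(H ∪ F) :=
    (hCH.mono (by rw [Finset.coe_union]; exact subset_union_left)).inter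
      (hAF.mono (by rw [Finset.coe_union]; exact subset_union_right))
  have hdisj : Disjoint (H ∪ F) G := by
    rw [Finset.disjoint_union_left]; exact ⟨hGH.symm, hFG⟩
  have h1 : (triSitePercolation t).real (C ∩ A ∩ B) =
      (triSitePercolation t).real (C ∩ A) * (triSitePercolation t).real B :=
    sitePercolation_real_inter_of_disjoint t hCA hBG hdisj
  have h2 : (triSitePercolation t).real (C ∩ A) =
      (triSitePercolation t).real C * (triSitePercolation t).real A :=
    sitePercolation_real_inter_of_disjoint t hCH hAF hFH.symm
  have h3 : (triSitePercolation t).real B = (triSitePercolation t).real E := by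
    rw [hB, triSitePercolation]; exact sitePercolation_real_preimage_relabel e t _
  rw [h1, h2, h3]
  rfl

/-- **Union bound over the local shapes** (`measureReal_le_of_subset_local` of
`FourArmPivotalBound.lean` with the inner four arms replaced by an abstract event `C` and the
outer four arms kept). [cite: Nolin2008, §6.2, proof of Thm. 27, Case 3 (arXiv 0711.4948: Thm. 26)] -/
theorem measureReal_le_of_subset_local_domOut (t : unitInterval) (c : Bool) {l : ℕ} (hl : 1 ≤ l)
    (hR₂N : R₂ ≤ N) (hvR₂ : triNorm v + 2 ^ l < R₂) (hCH : DeterminedBy C ↑H)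
    (hHm : ∀ z ∈ H, triNorm z < R₂ ∧ (2 : ℤ) ^ l < triNorm (z - v)) {S : Set (SiteConfig (Site 2))}
    (hdomS : S ⊆ C)
    (hout : S ⊆ armEvent ![true, false, true, false] R₂ N)
    (hloc : S ⊆ SiteConfig.relabel (triShiftIso (-v)).toEquiv ⁻¹'
      ((armEvent ![c, !c, c, !c] 1 (2 ^ (l - 1)) ∪ armEvent ![c, c, c, c, !c, !c] 2 (2 ^ l)) ∪
        ⋃ l' ∈ Finset.Ico 1 l, (armEvent ![c, !c, c, !c] 1 (2 ^ (l' - 1)) ∩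
          armEvent ![c, c, c, c, !c, !c] (2 ^ (l' + 1)) (2 ^ l)))) :
    (triSitePercolation t).real S ≤
      (triSitePercolation t).real C * fourArmProbAt t R₂ N *
        (fourArmProbAt t 1 (2 ^ (l - 1)) +
          (triSitePercolation t).real (armEvent ![c, c, c, c, !c, !c] 2 (2 ^ l)) +
          ∑ l' ∈ Finset.Ico 1 l, fourArmProbAt t 1 (2 ^ (l' - 1)) *
            (triSitePercolation t).real (armEvent ![c, c, c, c, !c, !c] (2 ^ (l' + 1)) (2 ^ l))) := by
  classical
  set μ := triSitePercolation t with hμ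
  set e := (triShiftIso (-v)).toEquiv with he
  set A := armEvent ![true, false, true, false] R₂ N with hA
  set E₀ : Set (SiteConfig (Site 2)) := armEvent ![c, !c, c, !c] 1 (2 ^ (l - 1)) with hE₀
  set E₁ : Set (SiteConfig (Site 2)) := armEvent ![c, c, c, c, !c, !c] 2 (2 ^ l) with hE₁
  set E : ℕ → Set (SiteConfig (Site 2)) := fun l' =>
    armEvent ![c, !c, c, !c] 1 (2 ^ (l' - 1)) ∩ armEvent ![c, c, c, c, !c, !c] (2 ^ (l' + 1)) (2 ^ l)
    with hEdef
  set T₀ := SiteConfig.relabel e ⁻¹' E₀ with hT₀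
  set T₁ := SiteConfig.relabel e ⁻¹' E₁ with hT₁
  set T : ℕ → Set (SiteConfig (Site 2)) := fun l' => SiteConfig.relabel e ⁻¹' E l' with hT
  have h2l : 2 ^ (l - 1) ≤ 2 ^ l := Nat.pow_le_pow_right (by norm_num) (by omega)
  have h2l' : (1 : ℕ) ≤ 2 ^ (l - 1) := Nat.one_le_two_pow
  have h22 : 2 ≤ 2 ^ l := by
    calc 2 = 2 ^ 1 := by norm_num
      _ ≤ 2 ^ l := Nat.pow_le_pow_right (by norm_num) hl
  have hcast : ((2 ^ l : ℕ) : ℤ) = (2 : ℤ) ^ l := by push_cast; ring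
  have hvR₂' : triNorm v + ((2 ^ l : ℕ) : ℤ) < R₂ := by rw [hcast]; exact hvR₂
  have hHm' : ∀ z ∈ H, triNorm z < R₂ ∧ (((2 ^ l : ℕ) : ℤ)) < triNorm (z - v) := by
    intro z hz; rw [hcast]; exact hHm z hz
  -- norms on annuli inside `Λ_{2^l}`
  have hann : ∀ (r d : ℕ), d ≤ 2 ^ l → ∀ u ∈ triAnnulus r d, triNorm u ≤ ((2 ^ l : ℕ) : ℤ) := by
    intro r d hd u hu
    rw [mem_triAnnulus] at hu
    have : (d : ℤ) ≤ ((2 ^ l : ℕ) : ℤ) := by exact_mod_cast hd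
    omega
  -- `S` inside the union of the pieces, each intersected with `C ∩ A`
  have hS : S ⊆ (C ∩ A ∩ T₀ ∪ C ∩ A ∩ T₁) ∪ ⋃ l' ∈ Finset.Ico 1 l, C ∩ A ∩ T l' := by
    intro ω hω
    have hAω := hout hω
    have hCω := hdomS hω
    have hL := hloc hω
    simp only [mem_preimage, mem_union, mem_iUnion, exists_prop] at hL
    rcases hL with (h | h) | ⟨l', hl', h⟩
    · exact mem_union_left _ (mem_union_left _ ⟨⟨hCω, hAω⟩, h⟩)
    · exact mem_union_left _ (mem_union_right _ ⟨⟨hCω, hAω⟩, h⟩)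
    · exact mem_union_right _ (mem_iUnion₂.2 ⟨l', hl', ⟨hCω, hAω⟩, h⟩)
  -- the four-arm probabilities of colour `c` are `fourArmProbAt`
  have h4 : ∀ r R : ℕ, μ.real (armEvent ![c, !c, c, !c] r R) = fourArmProbAt t r R := fun r R => by
    rw [hμ, fourArmProbAt, armEvent_altFour_eq]
  -- the pieces
  have e₀ : μ.real (C ∩ A ∩ T₀) = μ.real C * fourArmProbAt t R₂ N * fourArmProbAt t 1 (2 ^ (l - 1)) := by
    rw [hμ, hA, hT₀, measureReal_dom_outer_local_eq t (determinedBy_armEvent _ h2l')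
      (hann 1 _ h2l) hR₂N hvR₂' hCH hHm', ← hμ, h4]
  have e₁ : μ.real (C ∩ A ∩ T₁) = μ.real C * fourArmProbAt t R₂ N * μ.real E₁ := by
    rw [hμ, hA, hT₁, measureReal_dom_outer_local_eq t (determinedBy_armEvent _ h22)
      (hann 2 _ le_rfl) hR₂N hvR₂' hCH hHm', ← hμ]
  have e₂ : ∀ l' ∈ Finset.Ico 1 l, μ.real (C ∩ A ∩ T l') =
      μ.real C * fourArmProbAt t R₂ N *
        (fourArmProbAt t 1 (2 ^ (l' - 1)) *
          μ.real (armEvent ![c, c, c, c, !c, !c] (2 ^ (l' + 1)) (2 ^ l))) := by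
    intro l' hl'
    rw [Finset.mem_Ico] at hl'
    have hd : (1 : ℕ) ≤ 2 ^ (l' - 1) := Nat.one_le_two_pow
    have hdr : 2 ^ (l' - 1) < 2 ^ (l' + 1) := Nat.pow_lt_pow_right (by norm_num) (by omega)
    have hr'R : 2 ^ (l' + 1) ≤ 2 ^ l := Nat.pow_le_pow_right (by norm_num) (by omega)
    have hdet : DeterminedBy (E l') ↑(triAnnulus 1 (2 ^ (l' - 1)) ∪ triAnnulus (2 ^ (l' + 1)) (2 ^ l)) := by
      rw [hEdef]
      exact ((determinedBy_armEvent _ hd).mono (by rw [Finset.coe_union]; exact subset_union_left)).inter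
        ((determinedBy_armEvent _ hr'R).mono (by rw [Finset.coe_union]; exact subset_union_right))
    have hGE : ∀ u ∈ triAnnulus 1 (2 ^ (l' - 1)) ∪ triAnnulus (2 ^ (l' + 1)) (2 ^ l),
        triNorm u ≤ ((2 ^ l : ℕ) : ℤ) := by
      intro u hu
      rw [Finset.mem_union] at hu
      rcases hu with hu | hu
      · exact hann 1 _ (by omega) u hu
      · exact hann _ _ le_rfl u hu
    -- the probability of the local intersection factorises (disjoint annuli)
    have hloc2 : μ.real (E l') = fourArmProbAt t 1 (2 ^ (l' - 1)) *
        μ.real (armEvent ![c, c, c, c, !c, !c] (2 ^ (l' + 1)) (2 ^ l)) := by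
      rw [hEdef]
      simp only
      rw [hμ, triSitePercolation, sitePercolation_real_inter_of_disjoint t (determinedBy_armEvent _ hd)
        (determinedBy_armEvent _ hr'R), ← triSitePercolation, ← hμ, h4]
      rw [Finset.disjoint_left]
      intro u hu hu'
      rw [mem_triAnnulus] at hu hu'
      have : ((2 ^ (l' - 1) : ℕ) : ℤ) < ((2 ^ (l' + 1) : ℕ) : ℤ) := by exact_mod_cast hdr
      omega
    rw [hμ, hA, hT]
    simp only
    rw [measureReal_dom_outer_local_eq t hdet hGE hR₂N hvR₂' hCH hHm', ← hμ, hloc2]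
  calc μ.real S ≤ μ.real ((C ∩ A ∩ T₀ ∪ C ∩ A ∩ T₁) ∪ ⋃ l' ∈ Finset.Ico 1 l, C ∩ A ∩ T l') :=
        measureReal_mono hS (measure_ne_top _ _)
    _ ≤ μ.real (C ∩ A ∩ T₀ ∪ C ∩ A ∩ T₁) + μ.real (⋃ l' ∈ Finset.Ico 1 l, C ∩ A ∩ T l') :=
        measureReal_union_le _ _
    _ ≤ (μ.real (C ∩ A ∩ T₀) + μ.real (C ∩ A ∩ T₁)) +
          ∑ l' ∈ Finset.Ico 1 l, μ.real (C ∩ A ∩ T l') :=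
        add_le_add (measureReal_union_le _ _) (measureReal_biUnion_finset_le _ _)
    _ = μ.real C * fourArmProbAt t R₂ N *
          (fourArmProbAt t 1 (2 ^ (l - 1)) + μ.real (armEvent ![c, c, c, c, !c, !c] 2 (2 ^ l)) +
            ∑ l' ∈ Finset.Ico 1 l, fourArmProbAt t 1 (2 ^ (l' - 1)) *
              μ.real (armEvent ![c, c, c, c, !c, !c] (2 ^ (l' + 1)) (2 ^ l))) := by
        rw [e₀, e₁, Finset.sum_congr rfl e₂, ← Finset.mul_sum]
        ring

end Dom

/-! ### Per-site bounds in the inner boundary layer -/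

section InnerBoundary

variable {r₀ N l D d₂ k d' R₂ : ℕ} {v : Site 2}

/-- **Three factors for a pivotal site of the four-arm event near the inner boundary** (Nolin
2008, §6.2, proof of Thm. 27, Case 1, with §4.6; Werner 2009, Lecture 6, §5): for
`|v|_𝕋 = k = r₀ + d'`, `r₀ ≥ 1`, `l ≥ 1`, `2·2^l ≤ d'`, `1 ≤ D`, `2D ≤ k`, `k + D < R₂ ≤ N`,
`k + 2D ≤ N`, `2^l < d₂`, `d₂ + 2d' + 1 ≤ D`, and PROVIDED the exterior `{w | r₀ ≤ |w + v|_𝕋}` cut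
to `Λ_D` lies in the translate by a site `t` of norm `d'` of a rotated upper half-plane (`hdom`):
`P_t(v pivotal) ≤ P_t(B_{T,F}(d₂ + d', D - d')) · π̂_t(R₂, N) · (L_T + L_F)`,
`B_{T,F}(m, n) = domArmEvent ![T,F] m n upperHalfPlane`, `L_c` the local factors of
`measureReal_isPivotal_fourArm_le` (the mixed half-plane pair of
`shiftIn_mem_domArmEvent_mixed_of_isPivotal` recentred at `t` and rotated, the outer four arms, the
local event with its defect; the three are determined by disjoint site sets). [cite: Nolin2008, §4.6 and §6.2, proof of Thm. 27, Cases 1 and 3 (arXiv 0711.4948: Thm. 26)] [cite: WernerPCMI2009, Lecture 6, §5 and proof of Lemma 6.2 (boundary contributions)] -/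
theorem measureReal_isPivotal_fourArm_innerBoundary_le (t : unitInterval) (hk : triNorm v = k)
    (hkr : r₀ + d' = k) (hr₀ : 1 ≤ r₀) (hl : 1 ≤ l) (hld : 2 * 2 ^ l ≤ d') (hD : 1 ≤ D)
    (h2D : 2 * D ≤ k) (hR₂ : k + D < R₂) (hR₂N : R₂ ≤ N) (hDN : k + 2 * D ≤ N) (hd₂ : 2 ^ l < d₂)
    (hrec : d₂ + 2 * d' + 1 ≤ D)
    (hdom : ∃ (j : ℕ) (tt : Site 2), triNorm tt = d' ∧
      ∀ w : Site 2, (r₀ : ℤ) ≤ triNorm (w + v) → triNorm w ≤ D → w - tt ∈ (triRotIsoPow j) '' upperHalfPlane) :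
    (triSitePercolation t).real {ω | IsPivotal (armEvent ![true, false, true, false] r₀ N) v ω} ≤
      (triSitePercolation t).real (domArmEvent ![true, false] (d₂ + d') (D - d') upperHalfPlane) *
        fourArmProbAt t R₂ N *
        ∑ c : Bool, (fourArmProbAt t 1 (2 ^ (l - 1)) +
          (triSitePercolation t).real (armEvent ![c, c, c, c, !c, !c] 2 (2 ^ l)) +
          ∑ l' ∈ Finset.Ico 1 l, fourArmProbAt t 1 (2 ^ (l' - 1)) *
            (triSitePercolation t).real (armEvent ![c, c, c, c, !c, !c] (2 ^ (l' + 1)) (2 ^ l))) := by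
  classical
  obtain ⟨j, tt, htt, hdom⟩ := hdom
  set G : Set (Site 2) := (triRotIsoPow j) '' upperHalfPlane with hG
  set Hd : Set (Site 2) := {w | (r₀ : ℤ) ≤ triNorm (w + v) ∧ triNorm w ≤ D} with hHd
  set C : Set (SiteConfig (Site 2)) :=
    SiteConfig.relabel (triShiftIso (-v)).toEquiv ⁻¹' domArmEvent ![true, false] d₂ D Hd with hC
  set H : Finset (Site 2) := (triAnnulus d₂ D).image fun u => u + v with hH
  have hCH : DeterminedBy C ↑H :=
    determinedBy_preimage_shift (determinedBy_domArmEvent _ (by omega) Hd) v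
  have hcast : ((2 ^ l : ℕ) : ℤ) = (2 : ℤ) ^ l := by push_cast; ring
  have hHm : ∀ z ∈ H, triNorm z < R₂ ∧ (2 : ℤ) ^ l < triNorm (z - v) := by
    intro z hz
    rw [hH, Finset.mem_image] at hz
    obtain ⟨u, hu, rfl⟩ := hz
    rw [mem_triAnnulus] at hu
    have h1 := triNorm_add_le u v
    rw [add_sub_cancel_right, ← hcast]
    have hd₂' : ((2 ^ l : ℕ) : ℤ) < d₂ := by exact_mod_cast hd₂
    have hRk : ((k : ℤ) + D < R₂) := by exact_mod_cast hR₂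
    constructor
    · rw [hk] at h1; omega
    · omega
  have hvr' : (r₀ : ℤ) + 2 * 2 ^ l ≤ triNorm v := by rw [hk]; exact_mod_cast (show r₀ + 2 * 2 ^ l ≤ k by omega)
  have hvN' : triNorm v + 2 * 2 ^ l ≤ N := by
    rw [hk]
    have : 2 ^ l < D := by omega
    exact_mod_cast (show k + 2 * 2 ^ l ≤ N by omega)
  have hvr : (r₀ : ℤ) ≤ triNorm v := by rw [hk]; exact_mod_cast (show r₀ ≤ k by omega)
  have hv2 : 2 * (D : ℤ) ≤ triNorm v := by rw [hk]; exact_mod_cast h2D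
  have hvDN : triNorm v + 2 * D ≤ N := by rw [hk]; exact_mod_cast hDN
  have hvR₂ : triNorm v + 2 ^ l < R₂ := by
    rw [hk]
    have : 2 ^ l < D := by omega
    have h' : ((k : ℤ) + D < R₂) := by exact_mod_cast hR₂
    have h'' : ((2 : ℤ) ^ l < D) := by exact_mod_cast this
    omega
  have hvR₂' : triNorm v < R₂ := by
    have : (0 : ℤ) < (2 : ℤ) ^ l := by positivity
    omega
  -- the bound for one case, `S ⊆ pivotal`, with its local shape
  have hcase : ∀ (c : Bool) (S : Set (SiteConfig (Site 2))),
      S ⊆ {ω | IsPivotal (armEvent ![true, false, true, false] r₀ N) v ω} →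
      S ⊆ SiteConfig.relabel (triShiftIso (-v)).toEquiv ⁻¹'
        ((armEvent ![c, !c, c, !c] 1 (2 ^ (l - 1)) ∪ armEvent ![c, c, c, c, !c, !c] 2 (2 ^ l)) ∪
          ⋃ l' ∈ Finset.Ico 1 l, (armEvent ![c, !c, c, !c] 1 (2 ^ (l' - 1)) ∩
            armEvent ![c, c, c, c, !c, !c] (2 ^ (l' + 1)) (2 ^ l))) →
      (triSitePercolation t).real S ≤ (triSitePercolation t).real C * fourArmProbAt t R₂ N *
        (fourArmProbAt t 1 (2 ^ (l - 1)) +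
          (triSitePercolation t).real (armEvent ![c, c, c, c, !c, !c] 2 (2 ^ l)) +
          ∑ l' ∈ Finset.Ico 1 l, fourArmProbAt t 1 (2 ^ (l' - 1)) *
            (triSitePercolation t).real (armEvent ![c, c, c, c, !c, !c] (2 ^ (l' + 1)) (2 ^ l))) := by
    intro c S hS hloc
    refine measureReal_le_of_subset_local_domOut t c hl hR₂N hvR₂ hCH hHm ?_ ?_ hloc
    · intro ω hω
      exact shiftIn_mem_domArmEvent_mixed_of_isPivotal hr₀ hD hvr hv2 hvDN (hS hω) (by omega) (by omega)
    · exact hS.trans (isPivotal_armEvent_subset_outer (by omega) hR₂N hvR₂')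
  -- the two cases
  have hp := hcase true {ω | insert v ω ∈ armEvent ![true, false, true, false] r₀ N ∧
      ω \ {v} ∉ armEvent ![true, false, true, false] r₀ N} (fun ω hω => Or.inl hω)
    (fun ω hω => pivotalPlus_subset_local hl hvr' hvN' hω.1 hω.2)
  have hm := hcase false {ω | ω \ {v} ∈ armEvent ![true, false, true, false] r₀ N ∧
      insert v ω ∉ armEvent ![true, false, true, false] r₀ N} (fun ω hω => Or.inr hω)
    (fun ω hω => pivotalMinus_subset_local hl hvr' hvN' hω.1 hω.2)
  have hsplit : {ω : SiteConfig (Site 2) | IsPivotal (armEvent ![true, false, true, false] r₀ N) v ω} =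
      {ω | insert v ω ∈ armEvent ![true, false, true, false] r₀ N ∧
          ω \ {v} ∉ armEvent ![true, false, true, false] r₀ N} ∪
        {ω | ω \ {v} ∈ armEvent ![true, false, true, false] r₀ N ∧
          insert v ω ∉ armEvent ![true, false, true, false] r₀ N} := by
    ext ω; rfl
  -- the probability of `C`: recentre and rotate
  have hCle : (triSitePercolation t).real C ≤
      (triSitePercolation t).real (domArmEvent ![true, false] (d₂ + d') (D - d') upperHalfPlane) := by
    set C' : Set (SiteConfig (Site 2)) :=
      SiteConfig.relabel (triShiftIso (-(v + tt))).toEquiv ⁻¹'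
        domArmEvent ![true, false] (d₂ + d') (D - d') G with hC'
    have hdom' : ∀ w ∈ Hd, w - tt ∈ G := fun w hw => hdom w hw.1 hw.2
    have hCC' : C ⊆ C' := by
      intro ω hω
      have h3 := shift_mem_domArmEvent_recenter (κ := ![true, false]) (G := G) htt hrec hdom' hω
      rw [relabel_shift_shift] at h3
      exact h3
    have h4 : (triSitePercolation t).real C' =
        (triSitePercolation t).real (domArmEvent ![true, false] (d₂ + d') (D - d') upperHalfPlane) := by
      rw [hC', triSitePercolation, sitePercolation_real_preimage_relabel, hG]
      exact real_domArmEvent_rotPow t _ _ _ j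
    rw [← h4]
    exact measureReal_mono hCC' (measure_ne_top _ _)
  have hπ0 := fourArmProbAt_nonneg t R₂ N
  have hL0 : ∀ c : Bool, 0 ≤ fourArmProbAt t 1 (2 ^ (l - 1)) +
      (triSitePercolation t).real (armEvent ![c, c, c, c, !c, !c] 2 (2 ^ l)) +
      ∑ l' ∈ Finset.Ico 1 l, fourArmProbAt t 1 (2 ^ (l' - 1)) *
        (triSitePercolation t).real (armEvent ![c, c, c, c, !c, !c] (2 ^ (l' + 1)) (2 ^ l)) := by
    intro c
    refine add_nonneg (add_nonneg (fourArmProbAt_nonneg _ _ _) measureReal_nonneg) ?_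
    exact Finset.sum_nonneg fun l' _ => mul_nonneg (fourArmProbAt_nonneg _ _ _) measureReal_nonneg
  rw [hsplit]
  refine (measureReal_union_le _ _).trans ?_
  rw [Fintype.sum_bool]
  simp only [Bool.not_true, Bool.not_false] at hp hm hL0 ⊢
  have hT := hL0 true
  have hF := hL0 false
  simp only [Bool.not_true, Bool.not_false] at hT hF
  have hCm : (triSitePercolation t).real C * fourArmProbAt t R₂ N ≤
      (triSitePercolation t).real (domArmEvent ![true, false] (d₂ + d') (D - d') upperHalfPlane) *
        fourArmProbAt t R₂ N :=
    mul_le_mul_of_nonneg_right hCle hπ0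
  have hC0 : 0 ≤ (triSitePercolation t).real C * fourArmProbAt t R₂ N :=
    mul_nonneg measureReal_nonneg hπ0
  nlinarith [hp, hm, mul_le_mul_of_nonneg_right hCm hT, mul_le_mul_of_nonneg_right hCm hF]

/-- **Two factors for a pivotal site near the inner boundary** (the local factor dropped; any
depth `d' ≥ 0`): for `|v|_𝕋 = k = r₀ + d'`, `r₀ ≥ 1`, `1 ≤ D`, `2D ≤ k`, `k + D < R₂ ≤ N`,
`k + 2D ≤ N`, `1 ≤ d₂`, `d₂ + 2d' + 1 ≤ D`, and the half-plane hypothesis `hdom`: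
`P_t(v pivotal) ≤ P_t(B_{T,F}(d₂ + d', D - d')) · π̂_t(R₂, N)`. [cite: Nolin2008, §4.6 and §6.2, proof of Thm. 27, Case 1 (arXiv 0711.4948: Thm. 26)] [cite: WernerPCMI2009, Lecture 6, proof of Lemma 6.2 (boundary contributions)] -/
theorem measureReal_isPivotal_fourArm_innerBoundary_two_le (t : unitInterval) (hk : triNorm v = k)
    (hkr : r₀ + d' = k) (hr₀ : 1 ≤ r₀) (hD : 1 ≤ D) (h2D : 2 * D ≤ k) (hR₂ : k + D < R₂)
    (hR₂N : R₂ ≤ N) (hDN : k + 2 * D ≤ N) (hd₂ : 1 ≤ d₂) (hrec : d₂ + 2 * d' + 1 ≤ D)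
    (hdom : ∃ (j : ℕ) (tt : Site 2), triNorm tt = d' ∧
      ∀ w : Site 2, (r₀ : ℤ) ≤ triNorm (w + v) → triNorm w ≤ D → w - tt ∈ (triRotIsoPow j) '' upperHalfPlane) :
    (triSitePercolation t).real {ω | IsPivotal (armEvent ![true, false, true, false] r₀ N) v ω} ≤
      (triSitePercolation t).real (domArmEvent ![true, false] (d₂ + d') (D - d') upperHalfPlane) *
        fourArmProbAt t R₂ N := by
  classical
  obtain ⟨j, tt, htt, hdom⟩ := hdom
  set G : Set (Site 2) := (triRotIsoPow j) '' upperHalfPlane with hG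
  set Hd : Set (Site 2) := {w | (r₀ : ℤ) ≤ triNorm (w + v) ∧ triNorm w ≤ D} with hHd
  set A : Set (SiteConfig (Site 2)) := armEvent ![true, false, true, false] R₂ N with hA
  set C : Set (SiteConfig (Site 2)) :=
    SiteConfig.relabel (triShiftIso (-(v + tt))).toEquiv ⁻¹'
      domArmEvent ![true, false] (d₂ + d') (D - d') G with hC
  have hvr : (r₀ : ℤ) ≤ triNorm v := by rw [hk]; exact_mod_cast (show r₀ ≤ k by omega)
  have hv2 : 2 * (D : ℤ) ≤ triNorm v := by rw [hk]; exact_mod_cast h2D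
  have hvDN : triNorm v + 2 * D ≤ N := by rw [hk]; exact_mod_cast hDN
  have hvR₂' : triNorm v < R₂ := by
    rw [hk]; exact_mod_cast (show k < R₂ by omega)
  have hdom' : ∀ w ∈ Hd, w - tt ∈ G := fun w hw => hdom w hw.1 hw.2
  have hincl : {ω : SiteConfig (Site 2) | IsPivotal (armEvent ![true, false, true, false] r₀ N) v ω} ⊆
      C ∩ A := by
    intro ω hω
    have hω' : IsPivotal (armEvent ![true, false, true, false] r₀ N) v ω := hω
    refine ⟨?_, isPivotal_armEvent_subset_outer (by omega) hR₂N hvR₂' hω'⟩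
    have h2 := shiftIn_mem_domArmEvent_mixed_of_isPivotal hr₀ hD hvr hv2 hvDN hω' hd₂ (by omega)
    have h3 := shift_mem_domArmEvent_recenter (κ := ![true, false]) (G := G) htt hrec hdom' h2
    rw [relabel_shift_shift] at h3
    exact h3
  set F : Finset (Site 2) := triAnnulus R₂ N with hF
  set G₂ : Finset (Site 2) := (triAnnulus (d₂ + d') (D - d')).image fun u => u + (v + tt) with hG₂
  have hAF : DeterminedBy A ↑F := determinedBy_armEvent _ hR₂N
  have hCG : DeterminedBy C ↑G₂ :=
    determinedBy_preimage_shift (determinedBy_domArmEvent _ (by omega) G) (v + tt)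
  have hG₂mem : ∀ z ∈ G₂, triNorm z ≤ (k : ℤ) + D := by
    intro z hz
    rw [hG₂, Finset.mem_image] at hz
    obtain ⟨u, hu, rfl⟩ := hz
    rw [mem_triAnnulus] at hu
    push_cast [Nat.cast_sub (show d' ≤ D by omega)] at hu
    have h1 := triNorm_add_le (u + tt) v
    rw [show u + tt + v = u + (v + tt) by abel] at h1
    have h2 := triNorm_add_le u tt
    rw [htt] at h2
    rw [← hk]; omega
  have hFG₂ : Disjoint F G₂ := by
    rw [Finset.disjoint_left]
    intro z hzF hz
    rw [hF, mem_triAnnulus] at hzF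
    have := hG₂mem z hz
    have h' : ((k : ℤ) + D < R₂) := by exact_mod_cast hR₂
    omega
  have h1 : (triSitePercolation t).real (C ∩ A) =
      (triSitePercolation t).real C * (triSitePercolation t).real A :=
    sitePercolation_real_inter_of_disjoint t hCG hAF hFG₂.symm
  have h4 : (triSitePercolation t).real C =
      (triSitePercolation t).real (domArmEvent ![true, false] (d₂ + d') (D - d') upperHalfPlane) := by
    rw [hC, triSitePercolation, sitePercolation_real_preimage_relabel, hG]
    exact real_domArmEvent_rotPow t _ _ _ j
  calc (triSitePercolation t).real {ω | IsPivotal (armEvent ![true, false, true, false] r₀ N) v ω}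
      ≤ (triSitePercolation t).real (C ∩ A) := measureReal_mono hincl (measure_ne_top _ _)
    _ = (triSitePercolation t).real (domArmEvent ![true, false] (d₂ + d') (D - d') upperHalfPlane) *
        fourArmProbAt t R₂ N := by
        rw [h1, h4]; rfl

end InnerBoundary

/-! ### The half-plane hypothesis away from the corners of `Λ_{r₀}` -/

/-- `{0 ≤ z₀}` is the rotated upper half-plane `ρ⁴(upperHalfPlane)`. [folklore] -/
theorem mem_rot_four_upperHalfPlane_of_nonneg {z : Site 2} (hz : 0 ≤ z 0) :
    z ∈ (triRotIsoPow 4) '' upperHalfPlane := by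
  have h10 : (1 : Fin 2) ≠ 0 := by decide
  refine ⟨(triRotIsoPow 4).symm z, ?_, RelIso.apply_symm_apply _ z⟩
  simp only [mem_upperHalfPlane, triRotIsoPow_succ_symm_apply', triRotIsoPow_zero_symm_apply,
    triRotNeg60_apply_zero, triRotNeg60_apply_one]
  omega

/-- **The exterior of `Λ°_{r₀}` near a side, seen from `v`, lies in a half-plane at depth `d'`.**
Let `v = ρⁱ(k, -m)` (`ρ = triRotIso`, `0 ≤ m ≤ k`, a site of the `i`-th side of `∂Λ_k`), `k = r₀ + d'`,
and `D + d' < min(m, k - m)` (the box `Λ_D(v)` stays away from the two corners of the side). Then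
every `w` with `|w|_𝕋 ≤ D` and `r₀ ≤ |w + v|_𝕋` satisfies `w - t ∈ ρ^{i+4}(upperHalfPlane)` for
`t = ρⁱ(-d' e₀)` (`|t|_𝕋 = d'`): among the six linear forms defining `|w + v|_𝕋` only the one
attaining `|v|_𝕋` can reach `r₀` on the box. [folklore] -/
theorem exists_rot_halfPlane_superset_inner {r₀ k d' D m i : ℕ} {v : Site 2} (hmk : m ≤ k)
    (hv : v = triRotIsoPow i ![(k : ℤ), -(m : ℤ)]) (hkr : r₀ + d' = k) (hDm : D + d' < m)
    (hDm' : D + d' < k - m) :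
    ∃ (j : ℕ) (tt : Site 2), triNorm tt = d' ∧
      ∀ w : Site 2, (r₀ : ℤ) ≤ triNorm (w + v) → triNorm w ≤ D →
        w - tt ∈ (triRotIsoPow j) '' upperHalfPlane := by
  have h10 : (1 : Fin 2) ≠ 0 := by decide
  set z : Site 2 := ![(k : ℤ), -(m : ℤ)] with hz
  set tt₀ : Site 2 := Pi.single 0 (-(d' : ℤ)) with htt₀
  have hnormE0 : ∀ c : ℤ, triNorm (Pi.single 0 c : Site 2) = |c| := fun c => by
    simp [triNorm, h10]
  have htt₀n : triNorm tt₀ = d' := by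
    rw [htt₀, hnormE0, abs_neg, abs_of_nonneg (by positivity)]
  -- the unrotated statement
  have base : ∀ w' : Site 2, (r₀ : ℤ) ≤ triNorm (w' + z) → triNorm w' ≤ D → 0 ≤ (w' - tt₀) 0 := by
    intro w' hr hD
    obtain ⟨g0, g1, g2⟩ := abs_le_triNorm w'
    rw [abs_le] at g0 g1 g2
    have hkm : ((k - m : ℕ) : ℤ) = (k : ℤ) - m := by push_cast [Nat.cast_sub hmk]; ring
    have hDm'' : (D : ℤ) + d' < (k : ℤ) - m := by
      have : ((D + d' : ℕ) : ℤ) < ((k - m : ℕ) : ℤ) := by exact_mod_cast hDm'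
      push_cast at this; rw [hkm] at this; exact this
    have hge := le_triNorm_iff_lin.1 hr
    simp only [hz, Pi.add_apply, Matrix.cons_val_zero, Matrix.cons_val_one] at hge
    simp only [htt₀, Pi.sub_apply, Pi.single_eq_same]
    omega
  refine ⟨i + 4, triRotIsoPow i tt₀, by rw [triNorm_rot, htt₀n], fun w hr hD => ?_⟩
  set w' : Site 2 := (triRotIsoPow i).symm w with hw'
  have hww' : w = triRotIsoPow i w' := by rw [hw', RelIso.apply_symm_apply]
  have h1 : w + v = triRotIsoPow i (w' + z) := by
    rw [hww', hv, triRotIsoPow_apply_add]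
  have hr' : (r₀ : ℤ) ≤ triNorm (w' + z) := by rw [h1, triNorm_rot] at hr; exact hr
  have hD' : triNorm w' ≤ D := by rw [hww', triNorm_rot] at hD; exact hD
  have hb := mem_rot_four_upperHalfPlane_of_nonneg (base w' hr' hD')
  obtain ⟨y, hy, hyeq⟩ := hb
  refine ⟨y, hy, ?_⟩
  rw [show i + 4 = 4 + i from Nat.add_comm _ _, triRotIsoPow_add_apply, hyeq,
    triRotIsoPow_apply_sub, ← hww']

/-- The sites `ρⁱ(k, -m)`, `0 ≤ m ≤ k`, have graph norm `k`. [folklore] -/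
theorem triNorm_rot_side {k m i : ℕ} (hmk : m ≤ k) :
    triNorm (triRotIsoPow i ![(k : ℤ), -(m : ℤ)]) = k := by
  rw [triNorm_rot]
  apply le_antisymm
  · rw [triNorm_le_iff_lin]
    simp only [Matrix.cons_val_zero, Matrix.cons_val_one]
    omega
  · rw [le_triNorm_iff_lin]
    simp only [Matrix.cons_val_zero, Matrix.cons_val_one]
    omega

end Literature.Probability.Percolation
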